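import Summits.Ventures.QEC.Census.BB.A1s_n168_k6_cde6b9dd.AutsA
import Summits.Ventures.QEC.Census.BB.A1s_n168_k6_cde6b9dd.AutsB
import HarnessLib

set_option Elab.async false
set_option maxRecDepth 200000

/-!
# `[[168,6,16]]` one-level cover certificate of `A1s_n168_k6_cde6b9dd` — ASSEMBLY side: `hauts : autsCompatOK cov hx hz perms ePermqs rowss rowss`
(collector over `AutsA`/`AutsB`; `CertCoverProducers.autsCompatOK_of_forallL`). Theorems only; KERNEL. qec-search-1 g5.
-/

namespace Summit.Ventures.QEC.Census.A1s_n168_k6_cde6b9dd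

open Matrix Summit.Ventures.QEC.Census Literature.InformationTheory.QuantumCodes

/-- **`hauts`**: the automorphism tables of T1 (42 translations, index `i ↔ (i / 14, i % 14)`). -/
theorem hauts : autsCompatOK A1s_n168_k6_cde6b9dd.cov hx hz perms ePermqs rowss rowss = true := by
  refine autsCompatOK_of_forallL (by decide) fun i hi => ?_
  have hi' : i < 42 := by simpa [perms] using hi
  interval_cases i
  · exact aut0_ok
  · exact aut1_ok
  · exact aut2_ok
  · exact aut3_ok
  · exact aut4_ok
  · exact aut5_ok
  · exact aut6_ok
  · exact aut7_ok
  · exact aut8_ok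
  · exact aut9_ok
  · exact aut10_ok
  · exact aut11_ok
  · exact aut12_ok
  · exact aut13_ok
  · exact aut14_ok
  · exact aut15_ok
  · exact aut16_ok
  · exact aut17_ok
  · exact aut18_ok
  · exact aut19_ok
  · exact aut20_ok
  · exact aut21_ok
  · exact aut22_ok
  · exact aut23_ok
  · exact aut24_ok
  · exact aut25_ok
  · exact aut26_ok
  · exact aut27_ok
  · exact aut28_ok
  · exact aut29_ok
  · exact aut30_ok
  · exact aut31_ok
  · exact aut32_ok
  · exact aut33_ok
  · exact aut34_ok
  · exact aut35_ok
  · exact aut36_ok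
  · exact aut37_ok
  · exact aut38_ok
  · exact aut39_ok
  · exact aut40_ok
  · exact aut41_ok

end Summit.Ventures.QEC.Census.A1s_n168_k6_cde6b9dd
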